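import Summits.QuantumFields.YangMills.Theorems.ConvexGribovBodyBrascampLiebVacuumSCStubCubeOrbit
import Summits.QuantumFields.YangMills.Theorems.ConvexGribovBodyBrascampLiebVacuumSCStubCubeCount
import Summits.QuantumFields.YangMills.Theorems.ConvexGribovBodyBrascampLiebVacuumSCStubBlockAvgFloor

/-!
# Crux `BrascampLiebVacuumSC` (stmt-QuantumFields-16404), line `SketchIdeator1`, skeleton v5:
# the assembly `stub_cubeGlue` — a cube witness gives the volume-uniform Coulomb-gauge floor

Helper file of the line lead c2 (`prover-line-stmt-QuantumFields-16404-c2-0`). Skeleton v5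
(`Cruxes/BrascampLiebVacuumSC/Lines/SketchIdeator1.lean`) reshaped the floor `stub_floorCore` of v1–v4
(= the disprover's `CoulombGaugeAFloor r`: `∫ sup_{h ∈ argmin coul(U,·)} L⁻³ Σ_{j,y} ‖A^h_j(y)‖²_F dμ_{β,S} ≥ d > 0`
uniformly in the volume) into three provable stubs — the cube gauge-orbit functional `stub_cubeOrbit`
(p130567), the translate count `stub_cubeCount` (p130498) and the block link-freeing bound `stub_blockAvgFloor` —
plus ONE statement about the compact group `G` alone, the cube witness `stub_cubeWitness` (some configuration
of some `n × n × n` cube is not gauge-equivalent to an involution-valued one). This file is the assembly,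
the registered stub `stub_cubeGlue`: a cube witness `(n, u)` gives, for EVERY `β` and every torus `S ≥ n`,

`e^{−2|β|B·|cube links|} σ_n / n³ ≤ ∫ sup_{h ∈ argmin coul(U,·)} L⁻³ Σ_{j,y} ‖A^h_j(y)‖²_F dμ_{β,S}`,

where `σ_n = ∫ Q_n dHaar^{cube links} > 0` (`Q_n > 0` at the witness by the zero-set clause of `stub_cubeOrbit`,
`Q_n` continuous, product Haar charges open sets) and `B` is the one-link locality bound of the Wilson action
(`exists_wilsonAction_update_bound`). Steps: (1) in ANY gauge `h`, `Q_n(U|cube z) ≤` the anti-Hermitian mass of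
the cube's links (any-gauge clause with the cube gauge `k = h ∘ (z + ·)`; the endpoint of a valid cube link is
the shifted torus site); (2) summing over the `L³` translates counts each slice link `≤ n³` times
(`stub_cubeCount`), so the floor integrand is `≥ Σ_z Q_n(U|cube z) / (n³ L³)` at a minimiser `h₀`; (3) for each
translate, `E_μ Q_n(U|cube z) ≥ e^{−2|β|B|cube|} σ_n` by `stub_blockAvgFloor` with the injective embedding
`(x, j) ↦ ((0, z + x), j+1)` (injective since `2S+1 > n`; the frozen-background block average is the constant
`σ_n` by the dependence clause of `stub_cubeOrbit` and `Function.Injective.extend_apply`); (4) integrate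
(Berge integrability of the `sup` over the argmin, `FloorAssembly.integrable_iSup_subtype`). Everything is
proved; no named facts.
-/

set_option autoImplicit false

open scoped BigOperators Topology Matrix
open Filter MeasureTheory ProbabilityTheory
open Literature.MathematicalPhysics.QuantumFieldTheory
open Summit.QuantumFields.YangMills.Cruxes.CovarianceBound.SupportWindow
  (froSq coulombF IsCoulMin gluon modeCov supCov wilson4)

noncomputable section

namespace Summit.QuantumFields.YangMills.Theorems.BrascampLiebVacuumSC

open scoped ENNReal
open Summit.QuantumFields.YangMills.Theorems.BrascampLiebVacuum.Negative
open Summit.QuantumFields.YangMills.Theorems.BrascampLiebVacuumSC.Negative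
open Summit.QuantumFields.YangMills.Cruxes.CovarianceBound.SupportWindow.SupMeasurable

/-- **Assembly (`stub_cubeGlue` of skeleton v5): a cube witness gives the floor.** If the configuration `u` of
the `n × n × n` cube is not gauge-equivalent to an involution-valued one, then for every `β` there is `d > 0`
(namely `e^{−2|β|B·|cube links|} σ_n / n³`) with `d ≤ ∫ sup_{h ∈ argmin coul(U,·)} L⁻³ Σ_{j,y} ‖A^h_j(y)‖²_F dμ_{β,S}`
on every torus `(2S+1)⁴` with `S ≥ n`. See the module docstring for the four steps. [folklore] -/
theorem stub_cubeGlue :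
    ∀ (G : Type) [Group G] [TopologicalSpace G] [IsTopologicalGroup G] [CompactSpace G]
    [MeasurableSpace G] [BorelSpace G] (r : LatticeRep G) (β : ℝ) (n : ℕ)
    (u : (Fin 3 → Fin n) → Fin 3 → G),
    (∀ k : (Fin 3 → Fin n) → G, ∃ (x : Fin 3 → Fin n) (j : Fin 3) (h : (x j : ℕ) + 1 < n),
      k x * u x j * (k (Function.update x j ⟨(x j : ℕ) + 1, h⟩))⁻¹ *
        (k x * u x j * (k (Function.update x j ⟨(x j : ℕ) + 1, h⟩))⁻¹) ≠ 1) →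
    ∃ d : ℝ, 0 < d ∧ ∀ S : ℕ, n ≤ S →
      d ≤ ∫ U, (⨆ h : {h : Site 4 (2 * S + 1) → G // IsCoulMin r S U h},
        (∑ j : Fin 3, ∑ y : Fin 3 → ZMod (2 * S + 1), froSq (gluon r S U h.1 y j)) /
          ((2 * S + 1 : ℝ) ^ 3)) ∂(wilson4 r β S) := by
  intro G _ _ _ _ _ _ r β n u hu
  classical
  -- `n = 0` is vacuous (no cube sites)
  rcases Nat.eq_zero_or_pos n with hn0 | hnpos
  · subst hn0
    obtain ⟨x, -, -, -⟩ := hu fun _ => 1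
    exact (x 0).elim0
  obtain ⟨Q, hQc, hQ0, hQN, hQdep, hQle, hQzero⟩ := stub_cubeOrbit G r n
  obtain ⟨B, hB0, hB⟩ := exists_wilsonAction_update_bound r
  haveI : SecondCountableTopology G :=
    (r.continuous.isClosedEmbedding r.injective).isEmbedding.secondCountableTopology
  -- the valid links of the abstract cube and the extension of link values to all pairs `(x, j)`
  set ι : Type := {p : (Fin 3 → Fin n) × Fin 3 // (p.1 p.2 : ℕ) + 1 < n} with hι
  obtain ⟨ext, hext⟩ : ∃ ext : (ι → G) → (Fin 3 → Fin n) → Fin 3 → G,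
      ext = fun v x j => if h : (x j : ℕ) + 1 < n then v ⟨(x, j), h⟩ else 1 := ⟨_, rfl⟩
  have hextc : Continuous ext := by
    rw [hext]
    refine continuous_pi fun x => continuous_pi fun j => ?_
    by_cases h : (x j : ℕ) + 1 < n
    · simp only [dif_pos h]; exact continuous_apply _
    · simp only [dif_neg h]; exact continuous_const
  -- the block Haar average `σ` of `Q` and its positivity (the witness `u`)
  set π : Measure (ι → G) := Measure.pi fun _ : ι => haarProbability G with hπ
  set σ : ℝ := ∫ v, Q (ext v) ∂π with hσ
  have hQu : 0 < Q u := by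
    rcases (hQ0 u).lt_or_eq with h | h
    · exact h
    · exfalso
      obtain ⟨k, hk⟩ := hQzero u h.symm
      obtain ⟨x, j, hx, hne⟩ := hu k
      exact hne (hk x j hx)
  have hσpos : 0 < σ := by
    have hcont : Continuous fun v => Q (ext v) := hQc.comp hextc
    have hint : Integrable (fun v => Q (ext v)) π :=
      hcont.integrable_of_hasCompactSupport (HasCompactSupport.of_compactSpace _)
    rw [hσ, integral_pos_iff_support_of_nonneg (fun v => hQ0 _) hint]
    refine hcont.isOpen_support.measure_pos π ⟨fun i => u i.1.1 i.1.2, ?_⟩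
    rw [Function.mem_support]
    have heq : Q (ext fun i : ι => u i.1.1 i.1.2) = Q u := by
      refine hQdep _ _ fun x j h => ?_
      rw [hext]
      simp only [dif_pos h]
    rw [heq]
    exact hQu.ne'
  -- the constant
  set e : ℝ := Real.exp (-(2 * |β| * B * Fintype.card ι)) with he
  have he0 : 0 < e := Real.exp_pos _
  have hn3 : (0 : ℝ) < (n : ℝ) ^ 3 := by positivity
  refine ⟨e * σ / (n : ℝ) ^ 3, by positivity, fun S hS => ?_⟩
  haveI : Fact (1 < 2 * S + 1) := ⟨by omega⟩
  set L3 : ℝ := (2 * S + 1 : ℝ) ^ 3 with hL3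
  have hL3pos : 0 < L3 := by positivity
  -- embedded cube sites and the restriction of a torus configuration to the cube at `z`
  obtain ⟨site, hsiteq⟩ : ∃ site : (Fin 3 → ZMod (2 * S + 1)) → (Fin 3 → Fin n) → Site 4 (2 * S + 1),
      site = fun z x => Fin.cons (0 : ZMod (2 * S + 1)) (fun i => z i + ((x i : ℕ) : ZMod (2 * S + 1))) :=
    ⟨_, rfl⟩
  obtain ⟨restr, hrestr⟩ : ∃ restr : (Fin 3 → ZMod (2 * S + 1)) → GaugeConfig 4 (2 * S + 1) G →
      (Fin 3 → Fin n) → Fin 3 → G, restr = fun z U x j => U (site z x, j.succ) := ⟨_, rfl⟩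
  -- the shifted site of a valid link is the site of its endpoint
  have hshift : ∀ (z : Fin 3 → ZMod (2 * S + 1)) (x : Fin 3 → Fin n) (j : Fin 3)
      (h : (x j : ℕ) + 1 < n),
      Site.shift (d := 4) (site z x) j.succ = site z (Function.update x j ⟨(x j : ℕ) + 1, h⟩) := by
    intro z x j h
    rw [hsiteq]
    dsimp only
    rw [GaugeAlgebra.cons_zero_shift_succ]
    congr 1
    funext i
    simp only [Pi.add_apply]
    by_cases hij : i = j
    · subst hij
      simp only [Function.update_self, Pi.single_eq_same, Nat.cast_add, Nat.cast_one, add_assoc]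
    · simp only [Function.update_of_ne hij, Pi.single_eq_of_ne hij, add_zero]
  -- (1) the cube functional at `z` is below the mass of the cube's links in any gauge `h`
  have hcube : ∀ (U : GaugeConfig 4 (2 * S + 1) G) (h : Site 4 (2 * S + 1) → G)
      (z : Fin 3 → ZMod (2 * S + 1)),
      Q (restr z U) ≤ ∑ x : Fin 3 → Fin n, ∑ j : Fin 3,
        if (x j : ℕ) + 1 < n then
          froSq (gluon r S U h (fun i => z i + ((x i : ℕ) : ZMod (2 * S + 1))) j) else 0 := by
    intro U h z
    refine (hQle (fun x => h (site z x)) (restr z U)).trans (le_of_eq ?_)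
    refine Finset.sum_congr rfl fun x _ => Finset.sum_congr rfl fun j _ => ?_
    by_cases hv : (x j : ℕ) + 1 < n
    · rw [dif_pos hv, if_pos hv]
      rw [← hshift z x j hv]
      simp only [gluon, gaugeTransform, hrestr, hsiteq]
    · rw [dif_neg hv, if_neg hv]
  -- (2) summed over translates: `Σ_z Q ≤ n³ Σ_j Σ_y ‖A^h‖²` for every gauge `h`
  have hsum : ∀ (U : GaugeConfig 4 (2 * S + 1) G) (h : Site 4 (2 * S + 1) → G),
      (∑ z : Fin 3 → ZMod (2 * S + 1), Q (restr z U)) ≤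
        (n : ℝ) ^ 3 * ∑ j : Fin 3, ∑ y : Fin 3 → ZMod (2 * S + 1), froSq (gluon r S U h y j) := by
    intro U h
    have h1 := stub_cubeCount (2 * S + 1) n (fun y j => froSq (gluon r S U h y j))
      (fun y j => froSq_nonneg _)
    have h2 : (∑ y : Fin 3 → ZMod (2 * S + 1), ∑ j : Fin 3, froSq (gluon r S U h y j)) =
        ∑ j : Fin 3, ∑ y : Fin 3 → ZMod (2 * S + 1), froSq (gluon r S U h y j) := Finset.sum_comm
    rw [h2] at h1
    exact le_trans (Finset.sum_le_sum fun z _ => hcube U h z) h1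
  -- (3) the floor integrand dominates `Σ_z Q / (n³ L³)` pointwise (take a minimiser `h₀`)
  have hAmB : ∀ (U : GaugeConfig 4 (2 * S + 1) G) (h : Site 4 (2 * S + 1) → G),
      (∑ j : Fin 3, ∑ y : Fin 3 → ZMod (2 * S + 1), froSq (gluon r S U h y j)) ≤
        3 * r.N * L3 := by
    intro U h
    calc ∑ j : Fin 3, ∑ y : Fin 3 → ZMod (2 * S + 1), froSq (gluon r S U h y j)
        ≤ ∑ _j : Fin 3, ∑ _y : Fin 3 → ZMod (2 * S + 1), (r.N : ℝ) :=
          Finset.sum_le_sum fun j _ => Finset.sum_le_sum fun y _ => froSq_gluon_le r S U h y j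
      _ = 3 * r.N * L3 := by
          simp only [Finset.sum_const, Finset.card_univ, Fintype.card_fin, nsmul_eq_mul,
            card_slice, Nat.cast_ofNat, hL3]
          ring
  have hpt : ∀ U : GaugeConfig 4 (2 * S + 1) G,
      (∑ z : Fin 3 → ZMod (2 * S + 1), Q (restr z U)) / ((n : ℝ) ^ 3 * L3) ≤
      ⨆ h : {h : Site 4 (2 * S + 1) → G // IsCoulMin r S U h},
        (∑ j : Fin 3, ∑ y : Fin 3 → ZMod (2 * S + 1), froSq (gluon r S U h.1 y j)) / L3 := by
    intro U
    obtain ⟨h₀, hh₀⟩ := exists_isCoulMin r S U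
    have hbdd : BddAbove (Set.range fun h : {h : Site 4 (2 * S + 1) → G // IsCoulMin r S U h} =>
        (∑ j : Fin 3, ∑ y : Fin 3 → ZMod (2 * S + 1), froSq (gluon r S U h.1 y j)) / L3) :=
      ⟨3 * r.N * L3 / L3, by
        rintro _ ⟨h, rfl⟩
        exact div_le_div_of_nonneg_right (hAmB U h.1) hL3pos.le⟩
    refine le_trans ?_ (le_ciSup hbdd ⟨h₀, hh₀⟩)
    dsimp only
    rw [div_le_div_iff₀ (by positivity) hL3pos]
    have h1 := hsum U h₀
    calc (∑ z : Fin 3 → ZMod (2 * S + 1), Q (restr z U)) * L3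
        ≤ ((n : ℝ) ^ 3 * ∑ j : Fin 3, ∑ y : Fin 3 → ZMod (2 * S + 1), froSq (gluon r S U h₀ y j)) *
            L3 := mul_le_mul_of_nonneg_right h1 hL3pos.le
      _ = (∑ j : Fin 3, ∑ y : Fin 3 → ZMod (2 * S + 1), froSq (gluon r S U h₀ y j)) *
            ((n : ℝ) ^ 3 * L3) := by ring
  -- (4) each translate has `E_μ[Q(U|cube z)] ≥ e σ` (free the cube's links)
  have hrestr_cont : ∀ z : Fin 3 → ZMod (2 * S + 1), Continuous (restr z) := by
    intro z
    rw [hrestr]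
    exact continuous_pi fun x => continuous_pi fun j => continuous_apply _
  have hlt : ∀ y : Fin n, (y : ℕ) < 2 * S + 1 := fun y => by
    have := y.2
    omega
  have hblock : ∀ z : Fin 3 → ZMod (2 * S + 1),
      e * σ ≤ ∫ U, Q (restr z U) ∂(wilson4 r β S) := by
    intro z
    obtain ⟨emb, hemb⟩ : ∃ emb : ι → Edge 4 (2 * S + 1),
        emb = fun i => (site z i.1.1, Fin.succ i.1.2) := ⟨_, rfl⟩
    have hinj : Function.Injective emb := by
      rintro ⟨⟨x, j⟩, hx⟩ ⟨⟨x', j'⟩, hx'⟩ hxx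
      rw [hemb] at hxx
      simp only [Prod.mk.injEq] at hxx
      obtain ⟨h1, h2⟩ := hxx
      have hj : j = j' := Fin.succ_injective _ h2
      have hx1 : x = x' := by
        funext i
        have h3 := congrFun h1 i.succ
        rw [hsiteq] at h3
        simp only [Fin.cons_succ, add_right_inj] at h3
        rw [ZMod.natCast_eq_natCast_iff', Nat.mod_eq_of_lt (hlt _), Nat.mod_eq_of_lt (hlt _)] at h3
        exact Fin.ext h3
      subst hx1
      subst hj
      rfl
    have hkey : ∀ x : GaugeConfig 4 (2 * S + 1) G,
        σ ≤ ∫ v, Q (restr z (Function.extend emb v x)) ∂π := by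
      intro x
      have hfun : (fun v => Q (restr z (Function.extend emb v x))) = fun v => Q (ext v) := by
        funext v
        refine hQdep _ _ fun x' j' hv => ?_
        have h1 : restr z (Function.extend emb v x) x' j' =
            Function.extend emb v x (emb ⟨(x', j'), hv⟩) := by
          rw [hrestr, hemb]
        rw [h1, hinj.extend_apply, hext]
        simp only [dif_pos hv]
      rw [hfun]
    exact stub_blockAvgFloor G r β S ι emb hinj B (fun U e' g => hB (2 * S + 1) U e' g)
      (fun U => Q (restr z U)) (hQc.comp (hrestr_cont z)) (fun U => hQ0 _)
      (3 * (n : ℝ) ^ 3 * r.N) (fun U => hQN _) σ hkey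
  -- (5) integrate
  have hQz_int : ∀ z : Fin 3 → ZMod (2 * S + 1),
      Integrable (fun U : GaugeConfig 4 (2 * S + 1) G => Q (restr z U)) (wilson4 r β S) := fun z =>
    (hQc.comp (hrestr_cont z)).integrable_of_hasCompactSupport (HasCompactSupport.of_compactSpace _)
  have hQs_int : Integrable (fun U : GaugeConfig 4 (2 * S + 1) G =>
      (∑ z : Fin 3 → ZMod (2 * S + 1), Q (restr z U)) / ((n : ℝ) ^ 3 * L3)) (wilson4 r β S) :=
    (integrable_finsetSum _ fun z _ => hQz_int z).div_const _
  have hF_int : Integrable (fun U : GaugeConfig 4 (2 * S + 1) G =>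
      ⨆ h : {h : Site 4 (2 * S + 1) → G // IsCoulMin r S U h},
        (∑ j : Fin 3, ∑ y : Fin 3 → ZMod (2 * S + 1), froSq (gluon r S U h.1 y j)) / L3)
      (wilson4 r β S) :=
    FloorAssembly.integrable_iSup_subtype (wilson4 r β S) (isClosed_isCoulMin r S)
      (exists_isCoulMin r S)
      (f := fun U h => (∑ j : Fin 3, ∑ y : Fin 3 → ZMod (2 * S + 1), froSq (gluon r S U h y j)) / L3)
      ((continuous_finsetSum _ fun j _ => continuous_finsetSum _ fun y _ =>
        continuous_froSq.comp (continuous_gluon r S y j)).div_const _)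
      (fun U h => div_nonneg (Finset.sum_nonneg fun _ _ => Finset.sum_nonneg fun _ _ =>
        froSq_nonneg _) hL3pos.le)
      (fun U h => div_le_div_of_nonneg_right (hAmB U h) hL3pos.le)
  have hmono := integral_mono hQs_int hF_int hpt
  refine le_trans ?_ hmono
  rw [integral_div, integral_finsetSum _ fun z _ => hQz_int z]
  have hsumz : L3 * (e * σ) ≤
      ∑ z : Fin 3 → ZMod (2 * S + 1), ∫ U, Q (restr z U) ∂(wilson4 r β S) := by
    have h1 : (∑ _z : Fin 3 → ZMod (2 * S + 1), e * σ) = L3 * (e * σ) := by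
      rw [Finset.sum_const, Finset.card_univ, nsmul_eq_mul, card_slice]
    rw [← h1]
    exact Finset.sum_le_sum fun z _ => hblock z
  rw [div_le_div_iff₀ hn3 (mul_pos hn3 hL3pos)]
  nlinarith [mul_le_mul_of_nonneg_left hsumz hn3.le]

end Summit.QuantumFields.YangMills.Theorems.BrascampLiebVacuumSC

end
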